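import Summits.Ventures.HodgeRepro2.T5SU11JacobiLaplacePhase
import Summits.Ventures.HodgeRepro2.T5SU11JacobiWeightDeriv
import Summits.Ventures.HodgeRepro2.T5SU11OrbitMeasure

/-!
# The law of the orbit point on the disc in closed form:
`∫_G F(g·0) m_k φ_λ dν = ∫_{|z|<1} F(z) (1 − |z|²)^{k/2 − 2} Φ_λ(−½ log(1 − |z|²)) dA(z)`

The spherical function is a function of the orbit point through the phase,
`φ_λ(g) = Φ_λ(log|a(g)|) = Φ_λ(−½ log(1 − |g·0|²))` (`sph_eq_sphPhase_orbit`: `1 − |g·0|² = |a|⁻²`), so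
`m_k φ_λ` is `G_{k,λ}(g·0)` with `G_{k,λ}(z) = (1 − |z|²)^{k/2} Φ_λ(−½ log(1 − |z|²))`, and the orbit map
pushes `ν` to the Poincaré measure (`T5SU11OrbitMeasure.integral_nu_comp_orbit_of_aestronglyMeasurable`,
`μ_K(K) = 1`), `dpoincare = (1 − |z|²)^{−2} dA` on the unit disc. Hence, for every measurable `F` and
without any integrability hypothesis,

  **`∫_G F(g·0) m_k φ_λ dν = ∫_𝔻 F(z) (1 − |z|²)^{k/2} Φ_λ(−½ log(1 − |z|²)) dpoincare(z)`**
  **`= ∫_{|z|<1} F(z) (1 − |z|²)^{k/2 − 2} Φ_λ(−½ log(1 − |z|²)) dA(z)`**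

(`integral_orbit_mul_eq_poincare`, `integral_orbit_mul_eq_ball`): the law of the orbit point under
`m_k φ_λ dν / m̂_k(λ)` has the Lebesgue density `(1 − |z|²)^{k/2−2} Φ_λ(−½ log(1 − |z|²))/m̂_k(λ)` on the
disc — radial, as the rotation invariance of `T5SU11JacobiOrbitRotationLaw` requires. With `F = 1` and
`λ = 0` (`Φ_0 ≡ 1`, `m̂_k(0) = 2π/(k − 2)`) this evaluates the area integral
**`∫_{|z|<1} (1 − |z|²)^{k/2 − 2} dA = 2π/(k − 2)`** for `k > 2` (`integral_ball_one_sub_normSq_rpow`)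
through the group. Nothing is claimed about (N).

Blind lane: Mathlib + the HodgeRepro2 prefix only; no sorry; axioms ⊆ {propext, Classical.choice,
Quot.sound}.
-/

namespace Summit.Ventures.HodgeRepro2.T5SU11JacobiOrbitDiscLaw

open MeasureTheory MeasureTheory.Measure Metric Set Filter Topology
open T5SU11Unimodular T5SU11Fibration T5SU11Cartan T5HaarCircle T5BergmanCoefficient
  T5SU11FibrationHaar T5SU11SphericalFunction T5SU11SphericalSymmetry T5SU11SphericalBounds
  T5SU11SphericalContinuous T5SU11JacobiIwasawa T5SU11JacobiTransform T5SU11JacobiWeight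
  T5SU11KFiniteMajorantPow T5SU11OrbitMeasure T5PoincareMeasure T5SU11JacobiWeightDeriv
  T5SU11JacobiLaplacePhase
open scoped Real ENNReal

/-- `dens z · (1 − |z|²)^{k/2} = (1 − |z|²)^{k/2 − 2}` on the disc (`dens z = (1 − |z|²)⁻²`). -/
theorem dens_mul_rpow {z : ℂ} (hz : z ∈ ball (0 : ℂ) 1) (k : ℝ) :
    dens z * (1 - ‖z‖ ^ 2) ^ (k / 2) = (1 - ‖z‖ ^ 2) ^ (k / 2 - 2) := by
  have hz1 : ‖z‖ < 1 := by simpa using hz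
  have hpos : 0 < 1 - ‖z‖ ^ 2 := by nlinarith [norm_nonneg z]
  unfold dens
  rw [Complex.normSq_eq_norm_sq, Real.rpow_sub hpos, Real.rpow_two]
  field_simp

section measure

variable [MeasurableSpace Circle] [BorelSpace Circle]

/-- **The spherical function as a function of the orbit point**: `φ_λ(g) = Φ_λ(−½ log(1 − |g·0|²))`. -/
theorem sph_eq_sphPhase_orbit (lam : ℝ) (g : SU11) :
    sph lam g = sphPhase lam (-(1 / 2) * Real.log (1 - ‖orbit g‖ ^ 2)) := by
  rw [sph_eq_sphPhase, log_one_sub_norm_orbit_sq]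
  congr 1
  ring

/-- The disc-side integrand `G_{k,λ}(z) = (1 − |z|²)^{k/2} Φ_λ(−½ log(1 − |z|²))` is measurable. -/
theorem measurable_discIntegrand (k lam : ℝ) :
    Measurable fun z : ℂ => (1 - ‖z‖ ^ 2) ^ (k / 2) * sphPhase lam (-(1 / 2) * Real.log (1 - ‖z‖ ^ 2)) := by
  have h0 : Measurable fun z : ℂ => 1 - ‖z‖ ^ 2 := measurable_const.sub (measurable_norm.pow_const 2)
  exact (h0.pow_const (k / 2)).mul
    ((continuous_sphPhase lam).measurable.comp (measurable_const.mul (Real.measurable_log.comp h0)))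

/-- The integrand `F(g·0) m_k φ_λ` on `G` is `(F · G_{k,λ})(g·0)`. -/
theorem orbit_integrand_eq (F : ℂ → ℝ) (k lam : ℝ) (g : SU11) :
    F (orbit g) * ((1 - ‖orbit g‖ ^ 2) ^ (k / 2) * sph lam g)
      = (fun z : ℂ => F z * ((1 - ‖z‖ ^ 2) ^ (k / 2)
          * sphPhase lam (-(1 / 2) * Real.log (1 - ‖z‖ ^ 2)))) (orbit g) := by
  simp only
  rw [sph_eq_sphPhase_orbit]

/-- **THE LAW OF THE ORBIT POINT, POINCARÉ FORM**: for every measurable `F : ℂ → ℝ`,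
`∫_G F(g·0) m_k φ_λ dν = ∫_𝔻 F(z) (1 − |z|²)^{k/2} Φ_λ(−½ log(1 − |z|²)) dpoincare(z)`. -/
theorem integral_orbit_mul_eq_poincare {F : ℂ → ℝ} (hF : Measurable F) (k lam : ℝ) :
    ∫ g, F (orbit g) * ((1 - ‖orbit g‖ ^ 2) ^ (k / 2) * sph lam g) ∂(nu haarCircle)
      = ∫ z, F z * ((1 - ‖z‖ ^ 2) ^ (k / 2) * sphPhase lam (-(1 / 2) * Real.log (1 - ‖z‖ ^ 2)))
          ∂poincare := by
  rw [integral_congr_ae (Filter.Eventually.of_forall fun g => orbit_integrand_eq F k lam g),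
    integral_nu_comp_orbit_of_aestronglyMeasurable haarCircle
      (fun z : ℂ => F z * ((1 - ‖z‖ ^ 2) ^ (k / 2) * sphPhase lam (-(1 / 2) * Real.log (1 - ‖z‖ ^ 2))))
      (by exact (hF.mul (measurable_discIntegrand k lam)).aestronglyMeasurable),
    haarCircle_univ, ENNReal.toReal_one, one_smul]

/-- **THE LAW OF THE ORBIT POINT, LEBESGUE FORM**: for every measurable `F : ℂ → ℝ`,
`∫_G F(g·0) m_k φ_λ dν = ∫_{|z|<1} F(z) (1 − |z|²)^{k/2 − 2} Φ_λ(−½ log(1 − |z|²)) dA(z)`. -/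
theorem integral_orbit_mul_eq_ball {F : ℂ → ℝ} (hF : Measurable F) (k lam : ℝ) :
    ∫ g, F (orbit g) * ((1 - ‖orbit g‖ ^ 2) ^ (k / 2) * sph lam g) ∂(nu haarCircle)
      = ∫ z in ball (0 : ℂ) 1,
          F z * ((1 - ‖z‖ ^ 2) ^ (k / 2 - 2) * sphPhase lam (-(1 / 2) * Real.log (1 - ‖z‖ ^ 2))) := by
  rw [integral_orbit_mul_eq_poincare hF k lam]
  unfold poincare
  rw [integral_withDensity_eq_integral_toReal_smul (f := fun z => ENNReal.ofReal (dens z))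
    (by exact ENNReal.measurable_ofReal.comp measurable_dens)
    (Filter.Eventually.of_forall fun z => ENNReal.ofReal_lt_top)]
  refine setIntegral_congr_fun measurableSet_ball fun z hz => ?_
  simp only [smul_eq_mul]
  rw [ENNReal.toReal_ofReal (dens_nonneg z), ← dens_mul_rpow hz k]
  ring

/-- **The area integral `∫_{|z|<1} (1 − |z|²)^{k/2 − 2} dA = 2π/(k − 2)`** for `k > 2`, evaluated through
the group (`F = 1`, `λ = 0`). -/
theorem integral_ball_one_sub_normSq_rpow {k : ℝ} (hk : 2 < k) :
    ∫ z in ball (0 : ℂ) 1, (1 - ‖z‖ ^ 2) ^ (k / 2 - 2) = 2 * π / (k - 2) := by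
  have h := integral_orbit_mul_eq_ball (F := fun _ => (1 : ℝ)) measurable_const k 0
  simp only [one_mul, sphPhase_lam_zero, mul_one] at h
  rw [← h]
  exact integral_orbit_rpow_mul_sph_zero hk

end measure

end Summit.Ventures.HodgeRepro2.T5SU11JacobiOrbitDiscLaw
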